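/-
Origin: expansion seat `planner-pub-hodgecm-mc-theta-3-g13-0`, handover (BF) 2026-08-20T07:00:57Z md5 39a4c6fa70b8518f5f721da7657afd9c (200 l.; NEW additive drop-alone leaf over RUN-43 #1214 `ArchLineSlotTypeArch`; (J-μ) Step 1b: ctxSlotArchBox = follandFock (plane cmBigFrame) (∏_w rename (atPlace w) slotPlacePoly w); cert rc 0/10 s/0 warn/0 proof-hole; axioms 16/16 ⊆ trio) (`HOME/mc/pub-hodgecm-mc-theta-3-g13/lean/stage44/HodgeCM/Model/ArchSlotBoxFock.lean`, md5 39a4c6fa70b8, 200 lines);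
landed by the second packager p2 gen 4 (p2-g4) in gate run 44 as `HodgeCM/Model/ArchSlotBoxFock.lean` (verbatim).
-/
/-
Origin: speedrun cell pub-hodgecm, MODEL-CONSTRUCTION sub-cell, lineage mc-theta-3 (theta supply / second-lift lane, BINDER-OWNERS row 5 `S` slot),
seat planner-pub-hodgecm-mc-theta-3-g13-0 (gen 13), 2026-08-20.  Target in PKG: `HodgeCM/Model/ArchSlotBoxFock.lean`
(NEW additive drop-alone leaf; imports sinst-1's RUN-43 #1214 `Model/ArchLineSlotTypeArch` and two vendored Segal–Bargmann files).
KERNEL only: 0 records / `def … : Prop` / cites, 0 proof holes; intended closure {propext, Classical.choice, Quot.sound}.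
-/
import Summits.HodgeConjecture.HodgeCM.Model.ArchLineSlotTypeArch
import Literature.Analysis.SegalBargmann.SchwartzTensorPiBargmann
import Literature.RepresentationTheory.KonnoKonno2007.JunctionSwapBargmann

/-!
# (J-μ) STEP 1b: the archimedean slot box IS a Folland–Fock vector of the PLANE frame

#1214 (`Model/ArchLineSlotTypeArch`) reduced `hΔ₁` (slots 0, 1 of the (J-μ) residual) to an archimedean eigen-identity of
`ω_∞(hGR)(1, archDiag (dW c.D) (t₀,t₁))` on ONE Schwartz function `ctxSlotArchBox V c hpos₀ hpos₁ = slotArchBox (linePhi₀) (linePhi₁)`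
of `(L⁺ ⊗ ℝ)^{3·2}` (`slotTypeVec_sub_eq_of_arch_eigen`).  binder-2's engine (`HypCensus.cmArchWeilRep_torus_follandFock`) acts on
vectors of the shape `follandFock (cmBigFrame L finProdFinEquiv (frameD V) (dW c.D) ι₁) G`.  This leaf writes the slot box in that shape:

* §1 `slotCol`, `slotIdx`: the two line columns inside the plane's index set `Fin (3·2)` (resp. `Fin (3·2) × {real places}`), and
  their arithmetic (`finProdFinEquiv⁻¹ (slotCol (inl i)) = (i, 0)`, `… (inr i) = (i, 1)`);
* §2 `slotFrame_slotIdx_inl/inr`: the plane frame `cmBigFrame … finProdFinEquiv (frameD V) (dW S)` RESTRICTED to column `k` IS the line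
  frame `cmBigFrame … e₁ (frameD V) ⟨dW S k⟩` (same scalings `√|x_V| · √|x_W|`, entry by entry);
* §3 `slotArchBox_follandFock`: HENCE `slotArchBox (follandFock 𝔢₀ G₀) (follandFock 𝔢₁ G₁) = follandFock 𝔢 ((G₀ ⊗ G₁) ∘ slotIdx⁻¹)`
  (Segal–Bargmann: `B⁻¹` is multiplicative on separate variables, `binvPi_rename_mul`, and natural under relabelling);
* §4 `rename_slotIdx_prod_atPlace`: the relabelled product of two place products is the place product of the column-renamed factors;
  `ctxSlotArchBox_eq_follandFock`: **`ctxSlotArchBox V c hpos₀ hpos₁ = follandFock 𝔢 (∏_w (slotPlacePoly w)(z_{·,w}))`** with the EXPLICIT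
  place polynomials `slotPlacePoly w = P₀,w(col 0) · P₁,w(col 1)` of the two lines ((F1) `linePhi_eq_follandFock`): the literal input
  shape of `cmArchWeilRep_torus_follandFock` / `exists_character_cmArchWeilRep_follandFock`.

What then remains for slots 0, 1: the letter exponents of this (monomial) place product under the plane torus — binder-2's census.
Nothing here is a claim of PerL/QW8; nothing is cited as a fact.
-/

set_option autoImplicit false

noncomputable section

open scoped Matrix Classical SchwartzMap TensorProduct
open MvPolynomial (rename)
open NumberField (InfinitePlace maximalRealSubfield IsCMField)
open NumberField.mixedEmbedding (mixedSpace)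
open Literature.NumberTheory.Automorphic Literature.NumberTheory.Automorphic.UnitaryGroup Literature.NumberTheory.Weil1964
open Literature.NumberTheory.GelbartRogawski1991 Literature.NumberTheory.GelbartRogawski1991.UnitaryDualPair
open Literature.RepresentationTheory (atPlace)
open Literature.Analysis.SegalBargmann
open HodgeCM.Adelic HodgeCM.PerL34 HodgeCM.Model.HypCensus

namespace HodgeCM.Model.ArchSideTerm

/-! ## §1 the two line columns inside the plane -/

section Idx

/-- **the column embedding**: `inl i ↦ finProdFinEquiv (i, 0)`, `inr i ↦ finProdFinEquiv (i, 1)`, spelled exactly as the reindexings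
of `slotArchBox` compose (`e₁⁻¹`, then `(finProdSumEquiv 3 1 1)⁻¹`, then `finProdFinEquiv`). -/
def slotCol : Fin 3 ⊕ Fin 3 ≃ Fin (3 * 2) :=
  ((e₁.symm.sumCongr e₁.symm).trans (finProdSumEquiv 3 1 1).symm).trans finProdFinEquiv

/-- the column embedding on place-indexed variables: `inl (i, v) ↦ (slotCol (inl i), v)`, `inr (i, v) ↦ (slotCol (inr i), v)`. -/
def slotIdx (o : Type) : (Fin 3 × o) ⊕ (Fin 3 × o) ≃ Fin (3 * 2) × o :=
  (Equiv.sumProdDistrib (Fin 3) (Fin 3) o).symm.trans (slotCol.prodCongr (Equiv.refl o))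

/-- (Ported verbatim from the HodgeCMPerL package; no docstring in the source.) -/
theorem slotIdx_inl (o : Type) (i : Fin 3) (v : o) : slotIdx o (Sum.inl (i, v)) = (slotCol (Sum.inl i), v) := rfl

/-- (Ported verbatim from the HodgeCMPerL package; no docstring in the source.) -/
theorem slotIdx_inr (o : Type) (i : Fin 3) (v : o) : slotIdx o (Sum.inr (i, v)) = (slotCol (Sum.inr i), v) := rfl

/-- (Ported verbatim from the HodgeCMPerL package; no docstring in the source.) -/
theorem finProdFinEquiv_symm_slotCol_inl (i : Fin 3) : finProdFinEquiv.symm (slotCol (Sum.inl i)) = (i, 0) := by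
  revert i; decide

/-- (Ported verbatim from the HodgeCMPerL package; no docstring in the source.) -/
theorem finProdFinEquiv_symm_slotCol_inr (i : Fin 3) : finProdFinEquiv.symm (slotCol (Sum.inr i)) = (i, 1) := by
  revert i; decide

/-- (Ported verbatim from the HodgeCMPerL package; no docstring in the source.) -/
theorem e₁_symm_apply (i : Fin 3) : e₁.symm i = (i, 0) := by
  revert i; decide

/-- the relabelled box of two place products is the place product of the column-renamed factors. -/
theorem rename_slotIdx_prod_atPlace {o : Type} [Fintype o] (P Q : o → MvPolynomial (Fin 3) ℂ) :
    rename (slotIdx o) (rename Sum.inl (∏ w, rename (atPlace w) (P w)) * rename Sum.inr (∏ w, rename (atPlace w) (Q w))) =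
      ∏ w, rename (atPlace w) (rename (fun i => slotCol (Sum.inl i)) (P w) * rename (fun i => slotCol (Sum.inr i)) (Q w)) := by
  simp only [map_mul, map_prod, MvPolynomial.rename_rename]
  rw [← Finset.prod_mul_distrib]
  rfl

end Idx

/-! ## §2 the plane frame restricted to a column is the line frame -/

section Frame

variable {L : CMField} {ι₁ : L →+* ℂ} (V : HermSpace3 L ι₁) (S : StubTree.SeesawDatum L)

/-- the plane frame `𝔢 = cmBigFrame (frameD V ⊗ dW S)` on `(L⁺ ⊗ ℝ)^{3·2}`. -/
abbrev slotFrame :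
    (Fin (3 * 2) → mixedSpace (↥(maximalRealSubfield (L : Type)))) ≃L[ℝ]
      (Fin (3 * 2) × {v : InfinitePlace (↥(maximalRealSubfield (L : Type))) // v.IsReal} → ℝ) :=
  cmBigFrame (L : Type) finProdFinEquiv (frameD V) (frameD_real V) (frameD_ne V) (dW S) (dW_real S) (dW_ne S) ι₁

/-- the line frames `𝔢ₖ = cmBigFrame (frameD V ⊗ ⟨dW S k⟩)` on `(L⁺ ⊗ ℝ)^3`, `k = 0, 1` (the frames of (F1) `linePhi`). -/
abbrev lineFrame (k : Fin 2) :
    (Fin 3 → mixedSpace (↥(maximalRealSubfield (L : Type)))) ≃L[ℝ]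
      (Fin 3 × {v : InfinitePlace (↥(maximalRealSubfield (L : Type))) // v.IsReal} → ℝ) :=
  cmBigFrame (L : Type) e₁ (frameD V) (frameD_real V) (frameD_ne V) (lineVec (L : Type) (dW S k)) (fun _ => dW_real S k)
    (fun _ => dW_ne S k) ι₁

/-- **column 0 of the plane frame is the line-0 frame.** -/
theorem slotFrame_slotIdx_inl (x : Fin (3 * 2) → mixedSpace (↥(maximalRealSubfield (L : Type)))) (i : Fin 3)
    (v : {v : InfinitePlace (↥(maximalRealSubfield (L : Type))) // v.IsReal}) :
    slotFrame V S x (slotIdx _ (Sum.inl (i, v))) = lineFrame V S 0 (fun i' => x (slotCol (Sum.inl i'))) (i, v) := by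
  rw [slotIdx_inl, scaledFrame_apply, scaledFrame_apply]
  change cmDV (L : Type) (frameD V) (frameD_real V) ι₁ v (finProdFinEquiv.symm (slotCol (Sum.inl i))).1 *
      cmDW (L : Type) (frameD V) (dW S) (dW_real S) ι₁ v (finProdFinEquiv.symm (slotCol (Sum.inl i))).2 * (x (slotCol (Sum.inl i))).1 v =
    cmDV (L : Type) (frameD V) (frameD_real V) ι₁ v (e₁.symm i).1 *
      cmDW (L : Type) (frameD V) (lineVec (L : Type) (dW S 0)) (fun _ => dW_real S 0) ι₁ v (e₁.symm i).2 * (x (slotCol (Sum.inl i))).1 v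
  rw [finProdFinEquiv_symm_slotCol_inl, e₁_symm_apply]
  rfl

/-- **column 1 of the plane frame is the line-1 frame.** -/
theorem slotFrame_slotIdx_inr (x : Fin (3 * 2) → mixedSpace (↥(maximalRealSubfield (L : Type)))) (i : Fin 3)
    (v : {v : InfinitePlace (↥(maximalRealSubfield (L : Type))) // v.IsReal}) :
    slotFrame V S x (slotIdx _ (Sum.inr (i, v))) = lineFrame V S 1 (fun i' => x (slotCol (Sum.inr i'))) (i, v) := by
  rw [slotIdx_inr, scaledFrame_apply, scaledFrame_apply]
  change cmDV (L : Type) (frameD V) (frameD_real V) ι₁ v (finProdFinEquiv.symm (slotCol (Sum.inr i))).1 *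
      cmDW (L : Type) (frameD V) (dW S) (dW_real S) ι₁ v (finProdFinEquiv.symm (slotCol (Sum.inr i))).2 * (x (slotCol (Sum.inr i))).1 v =
    cmDV (L : Type) (frameD V) (frameD_real V) ι₁ v (e₁.symm i).1 *
      cmDW (L : Type) (frameD V) (lineVec (L : Type) (dW S 1)) (fun _ => dW_real S 1) ι₁ v (e₁.symm i).2 * (x (slotCol (Sum.inr i))).1 v
  rw [finProdFinEquiv_symm_slotCol_inr, e₁_symm_apply]
  rfl

end Frame

/-! ## §3 the slot box of two Folland–Fock vectors is a Folland–Fock vector of the plane frame -/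

section Box

variable {L : CMField} {ι₁ : L →+* ℂ} (V : HermSpace3 L ι₁) (S : StubTree.SeesawDatum L)

/-- **`slotArchBox (𝔢₀-Fock of G₀) (𝔢₁-Fock of G₁) = 𝔢-Fock of (G₀ ⊗ G₁) ∘ slotIdx⁻¹`.** -/
theorem slotArchBox_follandFock
    (G₀ G₁ : MvPolynomial (Fin 3 × {v : InfinitePlace (↥(maximalRealSubfield (L : Type))) // v.IsReal}) ℂ) :
    slotArchBox (follandFock (lineFrame V S 0) G₀) (follandFock (lineFrame V S 1) G₁) =
      follandFock (slotFrame V S) (rename (slotIdx _) (rename Sum.inl G₀ * rename Sum.inr G₁)) := by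
  ext x
  simp only [slotArchBox, schwartzReindexCLM_apply, archBoxTensor_apply, follandFock, schwartzTransport_symm_apply]
  rw [← schwartzTransport_relabelCLE_binvPi, schwartzTransport_apply, binvPi_rename_mul, tensorPi_apply]
  have h₀ : ((relabelCLE (slotIdx {v : InfinitePlace (↥(maximalRealSubfield (L : Type))) // v.IsReal})).symm (slotFrame V S x)) ∘
      Sum.inl = lineFrame V S 0 (fun i' => x (slotCol (Sum.inl i'))) := by
    funext k
    obtain ⟨i, v⟩ := k
    rw [Function.comp_apply, relabelCLE_symm_apply]
    exact slotFrame_slotIdx_inl V S x i v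
  have h₁ : ((relabelCLE (slotIdx {v : InfinitePlace (↥(maximalRealSubfield (L : Type))) // v.IsReal})).symm (slotFrame V S x)) ∘
      Sum.inr = lineFrame V S 1 (fun i' => x (slotCol (Sum.inr i'))) := by
    funext k
    obtain ⟨i, v⟩ := k
    rw [Function.comp_apply, relabelCLE_symm_apply]
    exact slotFrame_slotIdx_inr V S x i v
  rw [h₀, h₁]
  rfl

end Box

/-! ## §4 the slot box of the context as the Fock vector of an explicit place product -/

section Ctx

variable {L : CMField} {ι₁ : L →+* ℂ} (V : HermSpace3 L ι₁) (S : StubTree.SeesawDatum L)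
variable
  (hpos₀ : 0 < cmXW (L : Type) (frameD V) (lineVec (L : Type) (dW S 0)) (fun _ => dW_real S 0) ι₁ (HypCensus.cmPlace (L : Type) ι₁) 0)
  (hpos₁ : 0 < cmXW (L : Type) (frameD V) (lineVec (L : Type) (dW S 1)) (fun _ => dW_real S 1) ι₁ (HypCensus.cmPlace (L : Type) ι₁) 0)

/-- **the place polynomials of the slot box**: at each real place `w` of `L⁺`, the product of the two lines' place polynomials
((F1) `linePlacePoly`: degree one at `v₁`, the vacuum `1` elsewhere), line `k` renamed into column `k` of the plane. -/
def slotPlacePoly (w : {v : InfinitePlace (↥(maximalRealSubfield (L : Type))) // v.IsReal}) : MvPolynomial (Fin (3 * 2)) ℂ :=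
  rename (fun i => slotCol (Sum.inl i))
      (linePlacePoly Empty (L : Type) e₁ (frameD V) (frameD_real V) (lineVec (L : Type) (dW S 0)) (fun _ => dW_real S 0) ι₁
        (blockPosEquiv V) (blockNegEquiv V) (posIdxEquivUnit hpos₀) (negIdxEquivEmpty hpos₀) (Pi.single 0 1) w) *
    rename (fun i => slotCol (Sum.inr i))
      (linePlacePoly Empty (L : Type) e₁ (frameD V) (frameD_real V) (lineVec (L : Type) (dW S 1)) (fun _ => dW_real S 1) ι₁
        (blockPosEquiv V) (blockNegEquiv V) (posIdxEquivUnit hpos₁) (negIdxEquivEmpty hpos₁) (Pi.single 0 1) w)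

/-- **the slot box of the two line vectors is the plane-frame Fock vector of the place product of `slotPlacePoly`.** -/
theorem slotArchBox_linePhi_eq_follandFock :
    slotArchBox (linePhi V (dW S 0) (dW_real S 0) (dW_ne S 0) hpos₀) (linePhi V (dW S 1) (dW_real S 1) (dW_ne S 1) hpos₁) =
      follandFock (slotFrame V S) (∏ w, rename (atPlace w) (slotPlacePoly V S hpos₀ hpos₁ w)) := by
  rw [linePhi_eq_follandFock, linePhi_eq_follandFock, slotArchBox_follandFock, rename_slotIdx_prod_atPlace]
  rfl

/-- **HEADLINE — `ctxSlotArchBox V c hpos₀ hpos₁ = follandFock 𝔢 (∏_w slotPlacePoly w (z_{·,w}))`**: the vector of #1214's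
`slotTypeVec_sub_eq_of_arch_eigen` in the input shape of binder-2's `cmArchWeilRep_torus_follandFock`. -/
theorem ctxSlotArchBox_eq_follandFock (c : SeesawCtx L)
    (hpos₀ : 0 < cmXW (L : Type) (frameD V) (lineVec (L : Type) (dW c.D 0)) (fun _ => dW_real c.D 0) ι₁ (HypCensus.cmPlace (L : Type) ι₁) 0)
    (hpos₁ : 0 < cmXW (L : Type) (frameD V) (lineVec (L : Type) (dW c.D 1)) (fun _ => dW_real c.D 1) ι₁ (HypCensus.cmPlace (L : Type) ι₁) 0) :
    ctxSlotArchBox V c hpos₀ hpos₁ = follandFock (slotFrame V c.D) (∏ w, rename (atPlace w) (slotPlacePoly V c.D hpos₀ hpos₁ w)) :=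
  slotArchBox_linePhi_eq_follandFock V c.D hpos₀ hpos₁

end Ctx

end HodgeCM.Model.ArchSideTerm

end
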